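import Literature.MathematicalPhysics.QuantumFieldTheory.Balaban1983to89.T4Spectator
import Literature.MathematicalPhysics.QuantumFieldTheory.Balaban1983to89.T4DressingDefect
import Literature.MathematicalPhysics.QuantumFieldTheory.Balaban1983to89.T4MomentMayerStep

/-!
# `Balaban1983to89.T4ObservableTelescope` — OBSERVABLE-LEVEL TELESCOPING through Bałaban's chain `ρ_{k+1} = ℝ(Tρ_k)`:
# the exact ℝ-defect identity for a unit-lattice weight, its K-uniform summation lemma, and the one-term defect of the
# concrete operation (0.3) as «fibre mass × difference of conditional means» (cell T4, node O3b/H2 = NE1′; bookkeeping)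

HONEST FRAMING.  Audit cell `pub-balaban`, unit `b2b-balaban-t4-ne1p-p3` (T⁴-continuum fan-out, PROVER seat P3 for the
spine estimate NE1′ = DRESSED STABILITY in the observable-attached format, journal row `T4-O3.E-NE1′-PROVE-P3*`; companion
record `HOME/t4/T4-EST-NE1p-P3.md`).  ASSIGNED TECHNIQUE of the seat: «observable-level telescoping: write ⟨F⟩ differences
as telescoping sums over scales and bound each increment by the printed one-step contraction + the μ-derivative of the
effective action».  The cell's T4 target is the existence and uniqueness of the continuum limit of unit-scale averaged
loop expectations on a FINITE torus, with Bałaban's densities as GIVEN data satisfying the printed end statement (B) as a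
HYPOTHESIS; it is NOT an infinite-volume statement, NOT a mass gap, NOT the Clay problem, and this module is NOT progress on
any summit.  Value = kernel-checked bookkeeping: the EXACT identity behind the seat's technique, the abstract summation lemma
that says precisely which per-step sizes make it K-uniform, and the exact form of ONE increment in the tree's concrete model
of the operation (0.3) — so that the ONE inequality the technique needs and the series does not print can be read off as a
typed hypothesis shape (`CondMeanGap`, §3) instead of prose.  Every conditional of the cell (BetaPertH, (B), (B^μ)) is
absent here because nothing here uses it: no statement below is about Bałaban's actual densities beyond the printed SHAPES
(0.2)/(0.3)/(0.4) already typed in the tree.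

CITATION HEADER.  What is taken from T. Bałaban's series (CMP 1984–89) is ONLY what the imported tree modules already quote
and model, re-used BY NAME: the push-forward reading of a renormalization transformation `Setup.IsRT` ([Balaban1985Averaging]
(10) p. 19, tree DIVERGENCE F7); the ORDER of the two operations [Balaban1988Convergent] (0.2) p. 244 «ρ_k = RTρ_{k−1} =
(RT)^kρ₀» (tree `T4Continuum.Realisation.rho_succ_eq`, `T4Spectator.rho_succ_eq_R_Trho`); the normalization property
[Balaban1989LargeFieldI] (0.4) p. 176 «∫dV(Rρ)(V) = ∫dVρ(V)» (tree `Setup.PreservesIntegral`); and the concrete shape of the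
large-field operation [Balaban1989LargeFieldI] (0.3) p. 176 / (1.100)–(1.102) p. 201 as modelled by the tree's
`B15.BasicStep.normTerm` / `RopReal` / `fibreIntegral` («new(V)·∫dV⌈old/∫dV⌈new», the proviso «the denominators are positive»
= the hypothesis `den_ne` below) with its PROVED (1.102) `B15.BasicStep.integral_normTerm_eq`.  The conditional fibre law and
conditional mean `E_t[· | V_out]` are the tree's `T4DressingDefect.condLaw` / `condMean` (node O3b's D-term object: `D′(0) =
E[F | V_out] − F(ref)`, `T4DressingDefect.hasDerivAt_dTerm_zero` — THIS is the «μ-derivative of the effective action» of the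
seat's technique, now identified increment by increment, §3).  No page of the series was newly read for this module; no
sentence is newly attributed to it; nothing of Bałaban's averaging, of his small-field densities, or of his R beyond the
cited tree shapes is encoded (cell DIVERGENCE F6/F9 honoured).  ABSOLUTE RULE honoured: no programme-internal statement is a
hypothesis-free input — §1–§2 are over abstract carriers, §3 is over the tree's concrete model, §4 instantiates §1 on the
cell's data type `T4Continuum.FiniteEpsData` using only its fields.

WHAT IS PROVED (all [folklore] bookkeeping; no `sorry`, no new axiom):
§1 THE EXACT TELESCOPING IDENTITY (abstract, cast-free by recursion on the number of steps).  For one-step averagings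
   `av k : T^{(k)} → T^{(k+1)}`, densities `ρ k`, transforms `Tρ k` and operations `R k` forming a chain IN THE PRINTED
   ORDER (`PrintedChain`: `IsRT (av k).avg (ρ k) (Tρ k)` and `ρ (k+1) = R k (Tρ k)` for `k < K` — a HYPOTHESIS SHAPE, the
   fields `isRT_Trho`/`rho_succ_eq` of `T4Continuum.Realisation` abstracted), and a bounded measurable weight `f` on
   `T^{(K)}`:  `∫ρ₀(U) f(Ū^K) dU = ∫ρ_K(V) f(V) dV + Σ_{k<K} defect_k`, where `defect_k = ∫(Tρ_k) g_k − ∫ R_k(Tρ_k) g_k` is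
   the ℝ-DEFECT of the pulled-back weight `g_k = f ∘ avg_{K−1} ∘ ⋯ ∘ avg_{k+1}` (`telescopeSum`,
   `integral_zero_mul_comp_iter_eq`).  Consequences: total integrals `∫ρ_K = ∫ρ₀` from (0.4) alone
   (`integral_eq_integral_zero_of_printedChain`); the defect of a constant weight vanishes under (0.4) (`defect_const`,
   `telescopeSum_const`); the whole sum vanishes when every R-step preserves the integral of `Tρ_k` against every bounded
   measurable weight (`WeaklyInvisible` = the abstract form of `T4Spectator.RWeaklyInvisible`;
   `telescopeSum_eq_zero_of_weaklyInvisible` — the O3-alt collapse: then the observable is a spectator and the technique has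
   nothing to bound); the normalised form (`ratio_comp_iter_eq`).
§2 THE SUMMATION LEMMA (which per-step sizes make the technique K-uniform).  `DefectBoundedBy … a K f` (recursive predicate:
   the k-th defect of the pulled-back weight is `≤ a k` in absolute value) ⇒ `|Σ defects| ≤ Σ_{k<K} a k`
   (`abs_telescopeSum_le`); and if `a k ≤ C·r^{K−1−k}` with `0 ≤ r < 1` (geometric decay in the SCALE DISTANCE between the
   step and the observable) then `|Σ defects| ≤ C/(1−r)` UNIFORMLY IN K (`sum_range_le_of_geometric`,
   `abs_telescopeSum_le_of_geometric`).  This is the precise arithmetic content of the seat's verdict (record §3): per-step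
   sizes that do NOT decay geometrically in the scale distance (the first-order «sup-oscillation × large-field count» sizes —
   cell dead end (h)) give a bound growing with K; sizes carrying the factor `(θ₁φ)^{K−1−k}` against the count `L^{4(K−1−k)}`
   give `r = L⁴θ₁φ·(…)`, i.e. K-uniformity exactly under the cell's product condition.
§3 ONE INCREMENT IN THE CONCRETE MODEL OF (0.3).  For ONE term (insert `ins`, integrated density `old`, fibre `s = Λ`) under
   the printed provisos (`TermProvisos`: measurable, `0 ≤ · ≤ C`, `∫dV⌈_s ins ≠ 0`), the ONE-TERM DEFECT
   `termDefect s ins old g = ∫ old·g − ∫ normTerm(s,ins,old)·g` of a weight `g` satisfies: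
   (i) the defect of a finite sum of terms is the sum of the one-term defects (`defect_ropReal_eq_sum`,
   `defect_eq_sum_termDefect`); (ii) it VANISHES for every bounded measurable weight independent of the fibre variables
   (`termDefect_eq_zero_of_fibreIndep'` — (1.102) dressed by a spectator; the observable-level meaning: terms whose
   large-field region does not meet the support of the pulled-back loop contribute nothing); (iii) CENTRING and the
   FIRST-ORDER bound `|termDefect| ≤ 2δ·∫old` whenever `g` oscillates by at most `δ` around some fibre-independent `m`
   (`abs_termDefect_le_of_osc` — the «sup-oscillation × mass» size, sufficient per term, insufficient when summed: record §3);
   (iv) the EXACT CONDITIONAL-MEAN FORM for a nonnegative bounded weight: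
   `termDefect s ins old g = ∫ dV ∫dV⌈_s old(V) · (E^{old}_s[g | V_out] − E^{ins}_s[g | V_out])`
   (`termDefect_eq_integral_fibreIntegral_mul_sub`, via the tower identity `integral_fibreIntegral_eq` and
   `fibreIntegral_mul_eq_mul_condMean`) — the increment is the old term's fibre mass integrated against the DIFFERENCE OF THE
   TWO CONDITIONAL MEANS of the weight (old fibre law vs. insert fibre law), i.e. the difference of the two first μ-derivatives
   `D′(0)` of `T4DressingDefect`; hence (v) `|termDefect| ≤ ε·∫old` under the typed hypothesis shape `CondMeanGap s ins old g ε`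
   (`abs_termDefect_le_of_condMeanGap`; assembled over the terms of one ℝ-step: `abs_defect_ropReal_le_sum`, the per-step
   size «Σ_terms gap × mass» to be fed into §2).  `CondMeanGap` IS THE LOCATED MISSING INEQUALITY of the technique: nothing in the series
   bounds the difference of conditional means of a unit-lattice loop weight under the old term's and the insert's fibre laws;
   the cell's candidate size for it (row O3.E-i′, `T4FirstOrderSize`, NE1′ (b): `ε_t ≲ c·g_j²M⁴R_j²(θ₁φ)^{K−j}` at non-flat
   exteriors, Q22) is programme-internal and is NOT used here.
§4 THE CELL'S DATA.  For `D : T4Continuum.FiniteEpsData F G` the realised run `(K, g₀)` IS a printed chain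
   (`printedChain_rho`, from the fields `isRT_Trho`, `rho_succ_eq`), so UNCONDITIONALLY (given `D.AvgMeasurable`):
   `∫ρ₀ f(Ū^K) = ∫ρ_K f + telescopeSum` (`integral_rho_zero_mul_comp_iter_eq`) and the finite-ε Wilson expectation of any
   bounded measurable function of the K-fold averaged field is `(∫ρ_K f + telescopeSum)/∫ρ_K`
   (`expect_comp_iter_eq_telescope` — the unconditional companion of `T4Spectator.expect_comp_iter_eq`, whose hypothesis
   `hch`/`RWeaklyInvisible` is exactly `telescopeSum = 0`, `telescopeSum_rho_eq_zero_of_invisible`).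
§5 (v1.1, APPEND-ONLY) CONSUMER SEAMS.  The two-law gap from two ONE-LAW deviations `CondMeanDev` off a common
   fibre-independent reference (`condMeanGap_of_dev`, triangle inequality; the insert's positivity proviso supplies `hden`);
   linearity of the conditional mean and `E^{w}_s[m | V_out] = m(V)` for fibre-independent `m` (`condMean_sub`,
   `condMean_of_fibreIndep`); the FIRST/SECOND-ORDER CHANNEL SPLIT of a one-law deviation (`condMeanDev_of_channels`:
   «|conditional mean of the linear part| ≤ p» + «remainder ≤ q on the support of the law» ⇒ deviation `≤ p + q` — the typed
   form of record §3 (R1)/(R2); the sizes `p`, `q` for Bałaban's laws are the cell's GAPS G-ne1p3-1 and G-ne1p3-2, NOT printed, NOT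
   proved); and the NORMALISED BOUND `|⟨f(Ū^K)⟩ − ⟨f⟩_{ρ_K}| ≤ (Σ_{k<K} a_k)/∫ρ_K` under `DefectBoundedBy`
   (`abs_ratio_comp_iter_sub_le`, `abs_expect_comp_iter_sub_le`).

WHAT IS NOT PROVED.  No size of any defect for Bałaban's densities; no statement that Bałaban's R acts by (0.3) on a given
representation (§3 (i) takes `R σ = RopReal …` as a HYPOTHESIS); no K-uniform bound for the cell's observables — that is
NE1′ itself and needs `CondMeanGap`-type inputs per term and per step, which are the open rows O3.E-i′/Q22 of the cell's
T4-DAG.  Module path/namespace follow the tree's `Literature.<Topic>.<Sub>` convention (lean/CONVENTIONS.md §2).  Staged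
byte-identically in the cell package `run/shared/lean/pub/pub-balaban/lean/BalabanYm4/Literature/…/T4ObservableTelescope.lean`.
-/

noncomputable section

open MeasureTheory
open scoped BigOperators ENNReal

namespace Literature.MathematicalPhysics.QuantumFieldTheory.Balaban1983to89.T4ObservableTelescope

open T4Spectator

/-! ## §1 The exact telescoping identity along the printed-order chain (abstract carriers, cast-free) -/

section Chain

variable {P : Params} {G : Type*} [GaugeGroup G] [MeasurableSpace G] [HaarData G]

/-- THE ONE-STEP ℝ-DEFECT of a weight `g` on `T^{(j)}` for a density `σ` and an operation `R` on densities: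
`∫dV σ(V) g(V) − ∫dV (Rσ)(V) g(V)`.  For `g = 1` it vanishes under the printed (0.4) (`defect_const`); for general `g`
nothing is printed — this is the INCREMENT of the seat's telescoping sum. [folklore] -/
def defect {j : ℕ} (σ : Density P j G) (R : Density P j G → Density P j G) (g : GaugeField P j G → ℝ) : ℝ :=
  (∫ V, σ V * g V ∂fieldMeasure P j G) - ∫ V, R σ V * g V ∂fieldMeasure P j G

/-- HYPOTHESIS SHAPE (the fields `isRT_Trho`, `rho_succ_eq` of `T4Continuum.Realisation`, abstracted; nothing asserted):
a chain of densities IN THE PRINTED ORDER «ρ_k = RTρ_{k−1}» — for every `k < K`, `Tρ k` is the renormalization transform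
of `ρ k` along `(av k).avg` (tree `Setup.IsRT`) and `ρ (k+1) = R k (Tρ k)`. [cite: Balaban1988Convergent, (0.2) p.244] -/
structure PrintedChain (av : ∀ j, Averaging P j G) (ρ : (k : ℕ) → Density P k G)
    (Tρ : (k : ℕ) → Density P (k + 1) G) (R : (k : ℕ) → Density P (k + 1) G → Density P (k + 1) G) (K : ℕ) :
    Prop where
  /-- the T-steps, in the tree's push-forward reading -/
  isRT : ∀ k, k < K → IsRT (av k).avg (ρ k) (Tρ k)
  /-- (0.2): the next density is the R-image of the transform -/
  succ_eq : ∀ k, k < K → ρ (k + 1) = R k (Tρ k)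

/-- A printed chain up to `K` is one up to every `K' ≤ K`. [folklore] -/
theorem PrintedChain.mono {av : ∀ j, Averaging P j G} {ρ : (k : ℕ) → Density P k G}
    {Tρ : (k : ℕ) → Density P (k + 1) G} {R : (k : ℕ) → Density P (k + 1) G → Density P (k + 1) G} {K K' : ℕ}
    (h : PrintedChain av ρ Tρ R K) (hK : K' ≤ K) : PrintedChain av ρ Tρ R K' :=
  ⟨fun k hk => h.isRT k (lt_of_lt_of_le hk hK), fun k hk => h.succ_eq k (lt_of_lt_of_le hk hK)⟩

/-- THE TELESCOPING SUM of the ℝ-defects of a level-`K` weight `f` pulled back through the chain: by recursion on `K`,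
`telescopeSum (K+1) f = telescopeSum K (f ∘ avg_K) + defect_K(f)` — the k-th summand is the defect at step `k` of
`f ∘ avg_{K−1} ∘ ⋯ ∘ avg_{k+1}` (no casts between the levels are needed in this form). [folklore] -/
def telescopeSum (av : ∀ j, Averaging P j G) (Tρ : (k : ℕ) → Density P (k + 1) G)
    (R : (k : ℕ) → Density P (k + 1) G → Density P (k + 1) G) : (K : ℕ) → (GaugeField P K G → ℝ) → ℝ
  | 0, _ => 0
  | K + 1, f => telescopeSum av Tρ R K (fun U => f ((av K).avg U)) + defect (Tρ K) (R K) f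

/-- No step, no defect. [folklore] -/
theorem telescopeSum_zero (av : ∀ j, Averaging P j G) (Tρ : (k : ℕ) → Density P (k + 1) G)
    (R : (k : ℕ) → Density P (k + 1) G → Density P (k + 1) G) (f : GaugeField P 0 G → ℝ) :
    telescopeSum av Tρ R 0 f = 0 := rfl

/-- The recursion step of `telescopeSum`. [folklore] -/
theorem telescopeSum_succ (av : ∀ j, Averaging P j G) (Tρ : (k : ℕ) → Density P (k + 1) G)
    (R : (k : ℕ) → Density P (k + 1) G → Density P (k + 1) G) (K : ℕ) (f : GaugeField P (K + 1) G → ℝ) :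
    telescopeSum av Tρ R (K + 1) f = telescopeSum av Tρ R K (fun U => f ((av K).avg U)) + defect (Tρ K) (R K) f := rfl

/-- **THE EXACT OBSERVABLE-LEVEL TELESCOPING IDENTITY** (the seat's technique, as an identity): along a printed chain with
measurable averagings, for every bounded measurable weight `f` on `T^{(K)}`,
`∫dU ρ₀(U) f(Ū^K) = ∫dV ρ_K(V) f(V) + Σ_{k<K} [∫(Tρ_k) g_k − ∫ R_k(Tρ_k) g_k]`, `g_k` the pulled-back weight.  Proof: one
T-step (`IsRT`) moves `f` down one level exactly; one R-step costs exactly its defect; induct on `K`.  With all defects zero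
this is the spectator identity `T4Spectator.integral_mul_eq_integral_mul_comp_iter`. [folklore] -/
theorem integral_zero_mul_comp_iter_eq (av : ∀ j, Averaging P j G) (hav : ∀ j, Measurable (av j).avg)
    (ρ : (k : ℕ) → Density P k G) (Tρ : (k : ℕ) → Density P (k + 1) G)
    (R : (k : ℕ) → Density P (k + 1) G → Density P (k + 1) G) :
    ∀ (K : ℕ), PrintedChain av ρ Tρ R K → ∀ (f : GaugeField P K G → ℝ), Measurable f → (∃ C : ℝ, ∀ V, |f V| ≤ C) →
      ∫ U, ρ 0 U * f (Averaging.iter av K U) ∂fieldMeasure P 0 G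
        = ∫ V, ρ K V * f V ∂fieldMeasure P K G + telescopeSum av Tρ R K f
  | 0, _, f, _, _ => by rw [telescopeSum_zero, add_zero]; rfl
  | K + 1, hch, f, hf, hfb => by
    obtain ⟨C, hC⟩ := hfb
    have hstep : ∫ V, Tρ K V * f V ∂fieldMeasure P (K + 1) G = ∫ U, ρ K U * f ((av K).avg U) ∂fieldMeasure P K G :=
      hch.isRT K (Nat.lt_succ_self K) f hf ⟨C, hC⟩
    have ih := integral_zero_mul_comp_iter_eq av hav ρ Tρ R K (hch.mono (Nat.le_succ K))
      (fun U => f ((av K).avg U)) (hf.comp (hav K)) ⟨C, fun U => hC _⟩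
    calc ∫ U, ρ 0 U * f (Averaging.iter av (K + 1) U) ∂fieldMeasure P 0 G
        = ∫ U, ρ 0 U * f ((av K).avg (Averaging.iter av K U)) ∂fieldMeasure P 0 G := rfl
      _ = ∫ U, ρ K U * f ((av K).avg U) ∂fieldMeasure P K G
            + telescopeSum av Tρ R K (fun U => f ((av K).avg U)) := ih
      _ = ∫ V, Tρ K V * f V ∂fieldMeasure P (K + 1) G
            + telescopeSum av Tρ R K (fun U => f ((av K).avg U)) := by rw [hstep]
      _ = ∫ V, ρ (K + 1) V * f V ∂fieldMeasure P (K + 1) G + telescopeSum av Tρ R (K + 1) f := by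
          rw [telescopeSum_succ, hch.succ_eq K (Nat.lt_succ_self K), defect]; ring

/-- **TOTAL INTEGRALS ALONG A PRINTED CHAIN**: `∫dV ρ_K = ∫dU ρ₀` as soon as every R-step has the printed normalization
property (0.4) (each T-step preserves total mass by `T4Spectator.integral_eq_of_isRT`; no measurability needed). [cite: Balaban1989LargeFieldI, (0.4) p.176] -/
theorem integral_eq_integral_zero_of_printedChain (av : ∀ j, Averaging P j G) (ρ : (k : ℕ) → Density P k G)
    (Tρ : (k : ℕ) → Density P (k + 1) G) (R : (k : ℕ) → Density P (k + 1) G → Density P (k + 1) G) :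
    ∀ K : ℕ, PrintedChain av ρ Tρ R K → (∀ k, k < K → PreservesIntegral (R k)) →
      ∫ V, ρ K V ∂fieldMeasure P K G = ∫ U, ρ 0 U ∂fieldMeasure P 0 G
  | 0, _, _ => rfl
  | K + 1, hch, hR => by
    rw [hch.succ_eq K (Nat.lt_succ_self K), hR K (Nat.lt_succ_self K) (Tρ K),
      integral_eq_of_isRT (hch.isRT K (Nat.lt_succ_self K))]
    exact integral_eq_integral_zero_of_printedChain av ρ Tρ R K (hch.mono (Nat.le_succ K))
      (fun k hk => hR k (Nat.lt_succ_of_lt hk))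

/-- A defect whose two integrals agree is zero (the form in which invisibility hypotheses are consumed). [folklore] -/
theorem defect_eq_zero_of_integral_eq {j : ℕ} {σ : Density P j G} {R : Density P j G → Density P j G}
    {g : GaugeField P j G → ℝ}
    (h : ∫ V, R σ V * g V ∂fieldMeasure P j G = ∫ V, σ V * g V ∂fieldMeasure P j G) : defect σ R g = 0 := by
  rw [defect, h, sub_self]

/-- The defect of a CONSTANT weight vanishes under the printed (0.4) «∫dV(Rρ)(V) = ∫dVρ(V)». [cite: Balaban1989LargeFieldI, (0.4) p.176] -/
theorem defect_const {j : ℕ} (σ : Density P j G) {R : Density P j G → Density P j G} (hR : PreservesIntegral R)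
    (c : ℝ) : defect σ R (fun _ => c) = 0 := by
  refine defect_eq_zero_of_integral_eq ?_
  rw [integral_mul_const, integral_mul_const, hR σ]

/-- Hence the telescoping sum of a constant weight vanishes under (0.4) at every step (consistency with
`integral_eq_integral_zero_of_printedChain`). [folklore] -/
theorem telescopeSum_const (av : ∀ j, Averaging P j G) (Tρ : (k : ℕ) → Density P (k + 1) G)
    (R : (k : ℕ) → Density P (k + 1) G → Density P (k + 1) G) :
    ∀ (K : ℕ), (∀ k, k < K → PreservesIntegral (R k)) → ∀ c : ℝ, telescopeSum av Tρ R K (fun _ => c) = 0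
  | 0, _, _ => rfl
  | K + 1, hR, c => by
    rw [telescopeSum_succ, defect_const (Tρ K) (hR K (Nat.lt_succ_self K)) c, add_zero]
    exact telescopeSum_const av Tρ R K (fun k hk => hR k (Nat.lt_succ_of_lt hk)) c

/-- HYPOTHESIS SHAPE (named, never asserted, NOT printed — (0.4) is its weight-1 instance; the abstract form of
`T4Spectator.RWeaklyInvisible`): every R-step of the chain preserves the integral of `Tρ_k` against EVERY bounded measurable
weight.  [Balaban1988Convergent] p. 244 says R «changes expressions connected with the large field regions», so nothing
suggests it for Bałaban's R; it NAMES the situation in which the seat's technique has nothing to bound (O3-alt). [folklore] -/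
def WeaklyInvisible (Tρ : (k : ℕ) → Density P (k + 1) G) (R : (k : ℕ) → Density P (k + 1) G → Density P (k + 1) G)
    (K : ℕ) : Prop :=
  ∀ k, k < K → ∀ g : GaugeField P (k + 1) G → ℝ, Measurable g → (∃ C : ℝ, ∀ V, |g V| ≤ C) →
    ∫ V, R k (Tρ k) V * g V ∂fieldMeasure P (k + 1) G = ∫ V, Tρ k V * g V ∂fieldMeasure P (k + 1) G

/-- **THE O3-alt COLLAPSE**: along weakly invisible R-steps (and measurable averagings) the telescoping sum of every bounded
measurable weight is zero — the observable is then a spectator (`T4Spectator` §4). [folklore] -/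
theorem telescopeSum_eq_zero_of_weaklyInvisible (av : ∀ j, Averaging P j G) (hav : ∀ j, Measurable (av j).avg)
    (Tρ : (k : ℕ) → Density P (k + 1) G) (R : (k : ℕ) → Density P (k + 1) G → Density P (k + 1) G) :
    ∀ (K : ℕ), WeaklyInvisible Tρ R K → ∀ (f : GaugeField P K G → ℝ), Measurable f → (∃ C : ℝ, ∀ V, |f V| ≤ C) →
      telescopeSum av Tρ R K f = 0
  | 0, _, _, _, _ => rfl
  | K + 1, hW, f, hf, hfb => by
    obtain ⟨C, hC⟩ := hfb
    rw [telescopeSum_succ, defect_eq_zero_of_integral_eq (hW K (Nat.lt_succ_self K) f hf ⟨C, hC⟩), add_zero]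
    exact telescopeSum_eq_zero_of_weaklyInvisible av hav Tρ R K (fun k hk => hW k (Nat.lt_succ_of_lt hk))
      (fun U => f ((av K).avg U)) (hf.comp (hav K)) ⟨C, fun U => hC _⟩

/-- THE NORMALISED FORM: `∫ρ₀ f(Ū^K)/∫ρ₀ = (∫ρ_K f + telescopeSum)/∫ρ_K` — the expectation of a function of the averaged
field in the state `ρ₀` is its `ρ_K`-expectation PLUS the normalised telescoping sum ((0.4) at each R-step for the
denominators). [folklore] -/
theorem ratio_comp_iter_eq (av : ∀ j, Averaging P j G) (hav : ∀ j, Measurable (av j).avg)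
    (ρ : (k : ℕ) → Density P k G) (Tρ : (k : ℕ) → Density P (k + 1) G)
    (R : (k : ℕ) → Density P (k + 1) G → Density P (k + 1) G) (K : ℕ) (hch : PrintedChain av ρ Tρ R K)
    (hR : ∀ k, k < K → PreservesIntegral (R k)) (f : GaugeField P K G → ℝ) (hf : Measurable f)
    (hfb : ∃ C : ℝ, ∀ V, |f V| ≤ C) :
    (∫ U, ρ 0 U * f (Averaging.iter av K U) ∂fieldMeasure P 0 G) / (∫ U, ρ 0 U ∂fieldMeasure P 0 G)
      = (∫ V, ρ K V * f V ∂fieldMeasure P K G + telescopeSum av Tρ R K f) / ∫ V, ρ K V ∂fieldMeasure P K G := by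
  rw [integral_zero_mul_comp_iter_eq av hav ρ Tρ R K hch f hf hfb,
    integral_eq_integral_zero_of_printedChain av ρ Tρ R K hch hR]

end Chain

/-! ## §2 The summation lemma: which per-step sizes make the telescoping sum K-uniform -/

section Summation

variable {P : Params} {G : Type*} [GaugeGroup G] [MeasurableSpace G] [HaarData G]

/-- HYPOTHESIS SHAPE (per-step defect sizes): along the chain, the defect at step `k` of the weight `f` pulled back from
level `K` is at most `a k` in absolute value — by recursion on `K`, like `telescopeSum`. [folklore] -/
def DefectBoundedBy (av : ∀ j, Averaging P j G) (Tρ : (k : ℕ) → Density P (k + 1) G)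
    (R : (k : ℕ) → Density P (k + 1) G → Density P (k + 1) G) (a : ℕ → ℝ) :
    (K : ℕ) → (GaugeField P K G → ℝ) → Prop
  | 0, _ => True
  | K + 1, f => DefectBoundedBy av Tρ R a K (fun U => f ((av K).avg U)) ∧ |defect (Tρ K) (R K) f| ≤ a K

/-- No step, nothing to bound. [folklore] -/
theorem defectBoundedBy_zero (av : ∀ j, Averaging P j G) (Tρ : (k : ℕ) → Density P (k + 1) G)
    (R : (k : ℕ) → Density P (k + 1) G → Density P (k + 1) G) (a : ℕ → ℝ) (f : GaugeField P 0 G → ℝ) :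
    DefectBoundedBy av Tρ R a 0 f := trivial

/-- The recursion step of `DefectBoundedBy`. [folklore] -/
theorem defectBoundedBy_succ (av : ∀ j, Averaging P j G) (Tρ : (k : ℕ) → Density P (k + 1) G)
    (R : (k : ℕ) → Density P (k + 1) G → Density P (k + 1) G) (a : ℕ → ℝ) (K : ℕ)
    (f : GaugeField P (K + 1) G → ℝ) :
    DefectBoundedBy av Tρ R a (K + 1) f
      ↔ DefectBoundedBy av Tρ R a K (fun U => f ((av K).avg U)) ∧ |defect (Tρ K) (R K) f| ≤ a K := Iff.rfl

/-- **THE SUMMATION LEMMA**: per-step defect sizes add up — `|telescopeSum K f| ≤ Σ_{k<K} a k`. [folklore] -/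
theorem abs_telescopeSum_le (av : ∀ j, Averaging P j G) (Tρ : (k : ℕ) → Density P (k + 1) G)
    (R : (k : ℕ) → Density P (k + 1) G → Density P (k + 1) G) (a : ℕ → ℝ) :
    ∀ (K : ℕ) (f : GaugeField P K G → ℝ), DefectBoundedBy av Tρ R a K f →
      |telescopeSum av Tρ R K f| ≤ ∑ k ∈ Finset.range K, a k
  | 0, f, _ => by simp [telescopeSum_zero]
  | K + 1, f, h => by
    rw [defectBoundedBy_succ] at h
    rw [telescopeSum_succ, Finset.sum_range_succ]
    exact (abs_add_le _ _).trans (add_le_add (abs_telescopeSum_le av Tρ R a K _ h.1) h.2)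

/-- GEOMETRIC DECAY IN THE SCALE DISTANCE SUMS UNIFORMLY IN `K`: if `a k ≤ C·r^{K−1−k}` for `k < K` with `0 ≤ C` and
`0 ≤ r < 1`, then `Σ_{k<K} a k ≤ C/(1 − r)`.  (Reflect the sum and use `(1 − r)·Σ_{i<K} r^i = 1 − r^K`.) [folklore] -/
theorem sum_range_le_of_geometric {a : ℕ → ℝ} {K : ℕ} {C r : ℝ} (hC : 0 ≤ C) (hr0 : 0 ≤ r) (hr1 : r < 1)
    (h : ∀ k, k < K → a k ≤ C * r ^ (K - 1 - k)) : ∑ k ∈ Finset.range K, a k ≤ C / (1 - r) := by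
  have h1r : 0 < 1 - r := sub_pos.2 hr1
  have hs : ∑ k ∈ Finset.range K, r ^ k ≤ 1 / (1 - r) := by
    rw [le_div_iff₀ h1r, mul_comm, mul_neg_geom_sum]
    linarith [pow_nonneg hr0 K]
  calc ∑ k ∈ Finset.range K, a k ≤ ∑ k ∈ Finset.range K, C * r ^ (K - 1 - k) :=
        Finset.sum_le_sum fun k hk => h k (Finset.mem_range.1 hk)
    _ = C * ∑ k ∈ Finset.range K, r ^ k := by
        rw [← Finset.mul_sum, Finset.sum_range_reflect (fun k => r ^ k) K]
    _ ≤ C * (1 / (1 - r)) := mul_le_mul_of_nonneg_left hs hC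
    _ = C / (1 - r) := mul_one_div C (1 - r)

/-- **K-UNIFORMITY OF THE TECHNIQUE**: per-step defect sizes decaying geometrically in the scale distance to the observable
give `|telescopeSum K f| ≤ C/(1 − r)` for every `K`. [folklore] -/
theorem abs_telescopeSum_le_of_geometric (av : ∀ j, Averaging P j G) (Tρ : (k : ℕ) → Density P (k + 1) G)
    (R : (k : ℕ) → Density P (k + 1) G → Density P (k + 1) G) {a : ℕ → ℝ} {K : ℕ} {f : GaugeField P K G → ℝ}
    (h : DefectBoundedBy av Tρ R a K f) {C r : ℝ} (hC : 0 ≤ C) (hr0 : 0 ≤ r) (hr1 : r < 1)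
    (ha : ∀ k, k < K → a k ≤ C * r ^ (K - 1 - k)) : |telescopeSum av Tρ R K f| ≤ C / (1 - r) :=
  (abs_telescopeSum_le av Tρ R a K f h).trans (sum_range_le_of_geometric hC hr0 hr1 ha)

end Summation

/-! ## §3 One increment in the concrete model of (0.3): the one-term defect, its vanishing on fibre-independent weights,
the first-order (oscillation) bound, and the exact conditional-mean form -/

section OneTerm

open B15.BasicStep T4DressedR T4OscSandwich T4JointDressing T4DressingDefect T4MomentMayerStep

variable {P : Params} {j : ℕ} {G : Type*} [GaugeGroup G] [MeasurableSpace G] [HaarData G]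
variable [DecidableEq (PBond P j)]

/-- THE ONE-TERM ℝ-DEFECT of a weight `g`: `∫dV old(V) g(V) − ∫dV [ins(V)·∫dV⌈_s old/∫dV⌈_s ins] g(V)` — the contribution
of ONE term of (0.3)/(1.100) (insert `ins` = `ρ(Z″,·)`, integrated density `old` = `ρ(Z,·)`, fibre `s` = `Z′`/`Λ`) to the
defect of `g`.  For `g = 1` it is zero by the PROVED (1.102) `B15.BasicStep.integral_normTerm_eq`. [folklore] -/
def termDefect (s : Finset (PBond P j)) (ins old : Density P j G) (g : GaugeField P j G → ℝ) : ℝ :=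
  (∫ V, old V * g V ∂fieldMeasure P j G) - ∫ V, normTerm s ins old V * g V ∂fieldMeasure P j G

/-- THE PRINTED PROVISOS of one term of (0.3), bundled (hypotheses, never asserted of Bałaban's densities here): insert and
integrated density measurable, nonnegative, bounded by a common constant, and «the denominators are positive» —
`∫dV⌈_s ins ≠ 0` everywhere. [cite: Balaban1989LargeFieldI, (0.3) p.176] -/
structure TermProvisos (s : Finset (PBond P j)) (ins old : Density P j G) (C : ℝ) : Prop where
  ins_meas : Measurable ins
  old_meas : Measurable old
  ins_nonneg : ∀ V, 0 ≤ ins V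
  old_nonneg : ∀ V, 0 ≤ old V
  ins_le : ∀ V, ins V ≤ C
  old_le : ∀ V, old V ≤ C
  den_ne : ∀ V, fibreIntegral s ins V ≠ 0

omit [DecidableEq (PBond P j)] in
/-- A bounded measurable real function on gauge fields is integrable for the (probability) field measure. [folklore] -/
theorem integrable_of_measurable_abs_le {f : Density P j G} (hf : Measurable f) {B : ℝ} (hB : ∀ V, |f V| ≤ B) :
    Integrable f (fieldMeasure P j G) :=
  integrable_of_abs_le_ae hf.aemeasurable (Filter.Eventually.of_forall hB)

omit [DecidableEq (PBond P j)] in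
/-- Integrable × bounded measurable is integrable (in the order `f·g` used throughout). [folklore] -/
theorem integrable_mul_bdd {f g : Density P j G} (hf : Integrable f (fieldMeasure P j G)) (hg : Measurable g) {B : ℝ}
    (hB : ∀ V, |g V| ≤ B) : Integrable (fun V => f V * g V) (fieldMeasure P j G) :=
  (hf.bdd_mul hg.aestronglyMeasurable (Filter.Eventually.of_forall fun V => (Real.norm_eq_abs _).le.trans (hB V))).congr
    (Filter.Eventually.of_forall fun _ => mul_comm _ _)

namespace TermProvisos

variable {s : Finset (PBond P j)} {ins old : Density P j G} {C : ℝ}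

/-- The common bound is nonnegative (at any field). [folklore] -/
theorem nonneg_C (hP : TermProvisos s ins old C) (V : GaugeField P j G) : 0 ≤ C := (hP.old_nonneg V).trans (hP.old_le V)

/-- The integrated density is integrable. [folklore] -/
theorem integrable_old (hP : TermProvisos s ins old C) : Integrable old (fieldMeasure P j G) :=
  integrable_of_measurable_abs_le hP.old_meas fun V => by rw [abs_of_nonneg (hP.old_nonneg V)]; exact hP.old_le V

/-- The normalised term is integrable (`B15.BasicStep.integrable_normTerm`). [folklore] -/
theorem integrable_normTerm (hP : TermProvisos s ins old C) : Integrable (normTerm s ins old) (fieldMeasure P j G) :=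
  B15.BasicStep.integrable_normTerm s hP.ins_meas hP.old_meas hP.ins_nonneg hP.ins_le hP.old_le hP.den_ne

/-- (1.102) for the term: `∫ normTerm = ∫ old` (`B15.BasicStep.integral_normTerm_eq`). [cite: Balaban1989LargeFieldI, (1.102) p.201] -/
theorem integral_normTerm (hP : TermProvisos s ins old C) :
    ∫ V, normTerm s ins old V ∂fieldMeasure P j G = ∫ V, old V ∂fieldMeasure P j G :=
  integral_normTerm_eq s hP.ins_meas hP.old_meas hP.ins_nonneg hP.old_nonneg hP.ins_le hP.old_le hP.den_ne

/-- The normalised term is nonnegative. [folklore] -/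
theorem normTerm_nonneg (hP : TermProvisos s ins old C) (V : GaugeField P j G) : 0 ≤ normTerm s ins old V :=
  mul_nonneg (hP.ins_nonneg V) (div_nonneg (fibreIntegral_nonneg s old V) (fibreIntegral_nonneg s ins V))

/-- DRESSING THE INTEGRATED DENSITY by a nonnegative bounded measurable factor `h` keeps the provisos (with the common bound
`max C (C·B)`). [folklore] -/
theorem mul (hP : TermProvisos s ins old C) {h : Density P j G} (hhm : Measurable h) (hh0 : ∀ V, 0 ≤ h V) {B : ℝ}
    (hhB : ∀ V, h V ≤ B) : TermProvisos s ins (fun U => old U * h U) (max C (C * B)) where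
  ins_meas := hP.ins_meas
  old_meas := hP.old_meas.mul hhm
  ins_nonneg := hP.ins_nonneg
  old_nonneg V := mul_nonneg (hP.old_nonneg V) (hh0 V)
  ins_le V := (hP.ins_le V).trans (le_max_left _ _)
  old_le V := (mul_le_mul (hP.old_le V) (hhB V) (hh0 V) (hP.nonneg_C V)).trans (le_max_right _ _)
  den_ne := hP.den_ne

end TermProvisos

/-- **THE DEFECT OF (0.3) IS THE SUM OF THE ONE-TERM DEFECTS**: for `Tσ = Σ_Z ρ(Z,·)` and `ℝ(Tσ) = RopReal piece pp fib`
(the tree's concrete (0.3)), `∫(Σ_Z ρ(Z,·)) g − ∫ ℝ(Tσ) g = Σ_Z termDefect(Z′, ρ(Z″,·), ρ(Z,·), g)` for every bounded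
measurable weight `g`, under the provisos of every term. [folklore] -/
theorem defect_ropReal_eq_sum {R : Type*} [Fintype R] (piece : R → Density P j G) (pp : R → R)
    (fib : R → Finset (PBond P j)) {C : ℝ} (hP : ∀ Z, TermProvisos (fib Z) (piece (pp Z)) (piece Z) C)
    {g : GaugeField P j G → ℝ} (hg : Measurable g) {B : ℝ} (hgB : ∀ V, |g V| ≤ B) :
    (∫ V, (∑ Z, piece Z V) * g V ∂fieldMeasure P j G) - ∫ V, RopReal piece pp fib V * g V ∂fieldMeasure P j G
      = ∑ Z, termDefect (fib Z) (piece (pp Z)) (piece Z) g := by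
  have e1 : ∫ V, (∑ Z, piece Z V) * g V ∂fieldMeasure P j G = ∑ Z, ∫ V, piece Z V * g V ∂fieldMeasure P j G := by
    simp_rw [Finset.sum_mul]
    exact integral_finsetSum _ fun Z _ => integrable_mul_bdd (hP Z).integrable_old hg hgB
  have e2 : ∫ V, RopReal piece pp fib V * g V ∂fieldMeasure P j G
      = ∑ Z, ∫ V, normTerm (fib Z) (piece (pp Z)) (piece Z) V * g V ∂fieldMeasure P j G := by
    simp only [RopReal, Finset.sum_mul]
    exact integral_finsetSum _ fun Z _ => integrable_mul_bdd (hP Z).integrable_normTerm hg hgB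
  rw [e1, e2, ← Finset.sum_sub_distrib]
  rfl

/-- The same, phrased for the abstract `defect` of §1: IF the step's operation acts on the represented density by the
concrete (0.3) (a HYPOTHESIS `hR` — nothing asserts it of Bałaban's R), its defect is the sum of the one-term defects. [folklore] -/
theorem defect_eq_sum_termDefect {R : Type*} [Fintype R] (piece : R → Density P j G) (pp : R → R)
    (fib : R → Finset (PBond P j)) {C : ℝ} (hP : ∀ Z, TermProvisos (fib Z) (piece (pp Z)) (piece Z) C)
    {Rj : Density P j G → Density P j G} (hR : Rj (fun V => ∑ Z, piece Z V) = RopReal piece pp fib)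
    {g : GaugeField P j G → ℝ} (hg : Measurable g) {B : ℝ} (hgB : ∀ V, |g V| ≤ B) :
    defect (fun V => ∑ Z, piece Z V) Rj g = ∑ Z, termDefect (fib Z) (piece (pp Z)) (piece Z) g := by
  rw [← defect_ropReal_eq_sum piece pp fib hP hg hgB, defect, hR]

/-- Dressing the normalised term by a nonnegative FIBRE-INDEPENDENT factor is the normalised term of the dressed integrated
density: `normTerm(s,ins,old)·h = normTerm(s,ins,old·h)` pointwise (`T4DressedR.fibreIntegral_mul_of_fibreIndep`). [folklore] -/
theorem normTerm_mul_eq_of_fibreIndep (s : Finset (PBond P j)) (ins : Density P j G) {old : Density P j G}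
    (hm : Measurable old) {h : Density P j G} (hh : FibreIndep s h) (hh0 : ∀ V, 0 ≤ h V) (V : GaugeField P j G) :
    normTerm s ins old V * h V = normTerm s ins (fun U => old U * h U) V := by
  simp only [normTerm]
  rw [fibreIntegral_mul_of_fibreIndep s hm hh hh0 V]
  ring

/-- The one-term defect of a NONNEGATIVE bounded measurable fibre-independent weight vanishes ((1.102) for the dressed
integrated density). [folklore] -/
theorem termDefect_eq_zero_of_fibreIndep {s : Finset (PBond P j)} {ins old : Density P j G} {C : ℝ}
    (hP : TermProvisos s ins old C) {h : Density P j G} (hhm : Measurable h) (hh : FibreIndep s h)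
    (hh0 : ∀ V, 0 ≤ h V) {B : ℝ} (hhB : ∀ V, h V ≤ B) : termDefect s ins old h = 0 := by
  simp only [termDefect]
  simp_rw [normTerm_mul_eq_of_fibreIndep s ins hP.old_meas hh hh0]
  rw [(hP.mul hhm hh0 hhB).integral_normTerm, sub_self]

/-- The one-term defect is additive under differences of bounded measurable weights. [folklore] -/
theorem termDefect_sub {s : Finset (PBond P j)} {ins old : Density P j G} {C : ℝ} (hP : TermProvisos s ins old C)
    {g₁ g₂ : Density P j G} (hg₁ : Measurable g₁) {B₁ : ℝ} (hB₁ : ∀ V, |g₁ V| ≤ B₁) (hg₂ : Measurable g₂) {B₂ : ℝ}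
    (hB₂ : ∀ V, |g₂ V| ≤ B₂) :
    termDefect s ins old (fun V => g₁ V - g₂ V) = termDefect s ins old g₁ - termDefect s ins old g₂ := by
  simp only [termDefect, mul_sub]
  rw [integral_sub (integrable_mul_bdd hP.integrable_old hg₁ hB₁) (integrable_mul_bdd hP.integrable_old hg₂ hB₂),
    integral_sub (integrable_mul_bdd hP.integrable_normTerm hg₁ hB₁)
      (integrable_mul_bdd hP.integrable_normTerm hg₂ hB₂)]
  ring

/-- **TERMS AWAY FROM THE OBSERVABLE CONTRIBUTE NOTHING**: the one-term defect of every bounded measurable weight independent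
of the fibre variables vanishes (split `m = m⁺ − m⁻`).  Observable-level reading: a term whose integration region does not
meet the support of the pulled-back loop weight has zero defect. [folklore] -/
theorem termDefect_eq_zero_of_fibreIndep' {s : Finset (PBond P j)} {ins old : Density P j G} {C : ℝ}
    (hP : TermProvisos s ins old C) {m : Density P j G} (hmm : Measurable m) (hmI : FibreIndep s m) {Bm : ℝ}
    (hBm : ∀ V, |m V| ≤ Bm) : termDefect s ins old m = 0 := by
  have hposB : ∀ V, |max (m V) 0| ≤ Bm := fun V => by
    rw [abs_of_nonneg (le_max_right _ _)]
    exact max_le ((le_abs_self _).trans (hBm V)) ((abs_nonneg _).trans (hBm V))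
  have hnegB : ∀ V, |max (-m V) 0| ≤ Bm := fun V => by
    rw [abs_of_nonneg (le_max_right _ _)]
    exact max_le ((neg_le_abs _).trans (hBm V)) ((abs_nonneg _).trans (hBm V))
  have hpos : termDefect s ins old (fun V => max (m V) 0) = 0 :=
    termDefect_eq_zero_of_fibreIndep hP (hmm.max measurable_const) (fun V y => by rw [hmI V y])
      (fun V => le_max_right _ _) (B := Bm) (fun V => (le_abs_self _).trans (hposB V))
  have hneg : termDefect s ins old (fun V => max (-m V) 0) = 0 :=
    termDefect_eq_zero_of_fibreIndep hP (hmm.neg.max measurable_const) (fun V y => by rw [hmI V y])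
      (fun V => le_max_right _ _) (B := Bm) (fun V => (le_abs_self _).trans (hnegB V))
  have hsplit : m = fun V => max (m V) 0 - max (-m V) 0 := funext fun V => (max_zero_sub_max_neg_zero_eq_self (m V)).symm
  rw [hsplit, termDefect_sub hP (g₁ := fun V => max (m V) 0) (g₂ := fun V => max (-m V) 0) (hmm.max measurable_const)
    hposB (hmm.neg.max measurable_const) hnegB, hpos, hneg, sub_self]

/-- CENTRING: subtracting any bounded measurable fibre-independent `m` from the weight does not change the one-term defect.
[folklore] -/
theorem termDefect_eq_termDefect_sub {s : Finset (PBond P j)} {ins old : Density P j G} {C : ℝ}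
    (hP : TermProvisos s ins old C) {g : Density P j G} (hg : Measurable g) {B : ℝ} (hB : ∀ V, |g V| ≤ B)
    {m : Density P j G} (hmm : Measurable m) (hmI : FibreIndep s m) {Bm : ℝ} (hBm : ∀ V, |m V| ≤ Bm) :
    termDefect s ins old g = termDefect s ins old (fun V => g V - m V) := by
  rw [termDefect_sub hP hg hB hmm hBm, termDefect_eq_zero_of_fibreIndep' hP hmm hmI hBm, sub_zero]

/-- **THE FIRST-ORDER (OSCILLATION) SIZE OF ONE INCREMENT**: if the weight oscillates by at most `δ` around some bounded
measurable fibre-independent `m` (e.g. its value at a reference configuration of the fibre), then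
`|termDefect| ≤ 2δ·∫dV old` — «sup-oscillation of the pulled-back loop over the term's fibre × the term's mass».  Sufficient
per term; the record (§3) shows why these sizes alone do not sum uniformly in `K` (cell dead end (h)). [folklore] -/
theorem abs_termDefect_le_of_osc {s : Finset (PBond P j)} {ins old : Density P j G} {C : ℝ}
    (hP : TermProvisos s ins old C) {g : Density P j G} (hg : Measurable g) {B : ℝ} (hB : ∀ V, |g V| ≤ B)
    {m : Density P j G} (hmm : Measurable m) (hmI : FibreIndep s m) {Bm : ℝ} (hBm : ∀ V, |m V| ≤ Bm) {δ : ℝ}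
    (hδ : ∀ V, |g V - m V| ≤ δ) :
    |termDefect s ins old g| ≤ 2 * δ * ∫ V, old V ∂fieldMeasure P j G := by
  have key : ∀ {w : Density P j G}, (∀ V, 0 ≤ w V) → Integrable w (fieldMeasure P j G) →
      |∫ V, w V * (g V - m V) ∂fieldMeasure P j G| ≤ δ * ∫ V, w V ∂fieldMeasure P j G := by
    intro w hw0 hwi
    rw [← Real.norm_eq_abs]
    refine (norm_integral_le_of_norm_le (hwi.mul_const δ) (Filter.Eventually.of_forall fun V => ?_)).trans
      (le_of_eq ?_)
    · rw [Real.norm_eq_abs, abs_mul, abs_of_nonneg (hw0 V)]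
      exact mul_le_mul_of_nonneg_left (hδ V) (hw0 V)
    · rw [integral_mul_const, mul_comm]
  rw [termDefect_eq_termDefect_sub hP hg hB hmm hmI hBm, termDefect]
  calc |(∫ V, old V * (g V - m V) ∂fieldMeasure P j G) - ∫ V, normTerm s ins old V * (g V - m V) ∂fieldMeasure P j G|
      ≤ |∫ V, old V * (g V - m V) ∂fieldMeasure P j G| + |∫ V, normTerm s ins old V * (g V - m V) ∂fieldMeasure P j G| :=
        abs_sub _ _
    _ ≤ δ * ∫ V, old V ∂fieldMeasure P j G + δ * ∫ V, normTerm s ins old V ∂fieldMeasure P j G :=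
        add_le_add (key hP.old_nonneg hP.integrable_old) (key hP.normTerm_nonneg hP.integrable_normTerm)
    _ = 2 * δ * ∫ V, old V ∂fieldMeasure P j G := by rw [hP.integral_normTerm]; ring

/-! ### The exact conditional-mean form of one increment -/

/-- Fibre integrals are independent of the fibre variables (`B15.BasicStep.indepOf_lmarginal`, real form). [folklore] -/
theorem fibreIndep_fibreIntegral (s : Finset (PBond P j)) (f : Density P j G) : FibreIndep s (fibreIntegral s f) := by
  intro x y
  simp only [fibreIntegral]
  rw [indepOf_lmarginal (fun _ : PBond P j => (HaarData.haar : Measure G)) s (fun U => ENNReal.ofReal (f U)) x y]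

/-- Fibre integrals of measurable densities are measurable. [folklore] -/
theorem measurable_fibreIntegral (s : Finset (PBond P j)) {f : Density P j G} (hf : Measurable f) :
    Measurable (fibreIntegral s f) := by
  unfold fibreIntegral
  exact ((ofReal_comp_measurable hf).lmarginal _).ennreal_toReal

/-- A density bounded by `C ≥ 0` has fibre integrals bounded by `C` (normalised Haar fibres). [folklore] -/
theorem fibreIntegral_le_of_le (s : Finset (PBond P j)) {f : Density P j G} {C : ℝ} (hC0 : 0 ≤ C) (hC : ∀ U, f U ≤ C)
    (V : GaugeField P j G) : fibreIntegral s f V ≤ C := by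
  unfold fibreIntegral
  exact ENNReal.toReal_le_of_le_ofReal hC0 (lmarginal_ofReal_le s hC V)

/-- **THE TOWER IDENTITY** (real form of `B15.BasicStep.lintegral_lmarginal_eq`): integrating the fibre integral of a
nonnegative integrable measurable density over all fields gives back its integral, `∫dV ∫dV⌈_s f (V) = ∫dV f(V)`
(p. 194: the Λ-integration step preserves total integrals). [folklore] -/
theorem integral_fibreIntegral_eq (s : Finset (PBond P j)) {f : Density P j G} (hf : Measurable f) (h0 : ∀ U, 0 ≤ f U)
    (hfi : Integrable f (fieldMeasure P j G)) :
    ∫ V, fibreIntegral s f V ∂fieldMeasure P j G = ∫ V, f V ∂fieldMeasure P j G := by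
  have hLm : Measurable fun V : GaugeField P j G =>
      (∫⋯∫⁻_s, (fun U => ENNReal.ofReal (f U)) ∂(fun _ : PBond P j => (HaarData.haar : Measure G))) V :=
    (ofReal_comp_measurable hf).lmarginal (fun _ : PBond P j => (HaarData.haar : Measure G))
  have hlin : ∫⁻ V, (∫⋯∫⁻_s, (fun U => ENNReal.ofReal (f U)) ∂(fun _ : PBond P j => (HaarData.haar : Measure G))) V
        ∂fieldMeasure P j G
      = ∫⁻ V, ENNReal.ofReal (f V) ∂fieldMeasure P j G := by
    rw [fieldMeasure_eq_pi]
    exact lintegral_lmarginal_eq (fun _ : PBond P j => (HaarData.haar : Measure G)) s (ofReal_comp_measurable hf)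
  have hfin : ∫⁻ V, ENNReal.ofReal (f V) ∂fieldMeasure P j G ≠ ∞ :=
    ((hasFiniteIntegral_iff_ofReal (Filter.Eventually.of_forall h0)).1 hfi.hasFiniteIntegral).ne
  rw [← hlin] at hfin
  have hae : ∀ᵐ V ∂fieldMeasure P j G,
      (∫⋯∫⁻_s, (fun U => ENNReal.ofReal (f U)) ∂(fun _ : PBond P j => (HaarData.haar : Measure G))) V < ∞ :=
    ae_lt_top hLm hfin
  rw [integral_eq_lintegral_of_nonneg_ae (Filter.Eventually.of_forall h0) hf.aestronglyMeasurable, ← hlin,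
    ← integral_toReal hLm.aemeasurable hae]
  rfl

/-- THE CONDITIONAL MEAN IS A RATIO OF FIBRE INTEGRALS for nonnegative weights:
`E_s[g | V_out] = ∫dV⌈_s(w·g)/∫dV⌈_s w` (`T4DressingDefect.condMean_eq_div` + `T4MomentMayerStep.fibreIntegral_eq_integral`).
[folklore] -/
theorem condMean_eq_fibreIntegral_div (s : Finset (PBond P j)) {w : Density P j G} (hm : Measurable w)
    (h0 : ∀ U, 0 ≤ w U) {g : Density P j G} (hg : Measurable g) (hg0 : ∀ U, 0 ≤ g U) (V : GaugeField P j G) :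
    condMean s w g V = fibreIntegral s (fun U => w U * g U) V / fibreIntegral s w V := by
  rw [condMean_eq_div s hm h0 g V,
    fibreIntegral_eq_integral s (f := fun U => w U * g U) (hm.mul hg) (fun U => mul_nonneg (h0 U) (hg0 U)) V]

/-- Hence the conditional mean of a nonnegative measurable weight is a measurable function of the field. [folklore] -/
theorem measurable_condMean (s : Finset (PBond P j)) {w : Density P j G} (hm : Measurable w) (h0 : ∀ U, 0 ≤ w U)
    {g : Density P j G} (hg : Measurable g) (hg0 : ∀ U, 0 ≤ g U) : Measurable fun V => condMean s w g V := by
  have e : (fun V => condMean s w g V) = fun V => fibreIntegral s (fun U => w U * g U) V / fibreIntegral s w V :=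
    funext fun V => condMean_eq_fibreIntegral_div s hm h0 hg hg0 V
  rw [e]
  exact (measurable_fibreIntegral s (hm.mul hg)).div (measurable_fibreIntegral s hm)

/-- The conditional mean of a weight with `|g| ≤ B` is at most `B` in absolute value (the conditional law is zero or a
probability measure, `T4DressingDefect.isZeroOrProbabilityMeasure_condLaw`). [folklore] -/
theorem abs_condMean_le (s : Finset (PBond P j)) {w : Density P j G} {C : ℝ} (hC : ∀ U, w U ≤ C) {g : Density P j G}
    {B : ℝ} (hB : ∀ U, |g U| ≤ B) (V : GaugeField P j G) : |condMean s w g V| ≤ B := by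
  haveI := isZeroOrProbabilityMeasure_condLaw s hC V (old := w)
  have hB0 : 0 ≤ B := (abs_nonneg _).trans (hB V)
  have h : ‖∫ y, g (Function.updateFinset V s y) ∂(condLaw s w V)‖ ≤ B * (condLaw s w V).real Set.univ :=
    norm_integral_le_of_norm_le_const (Filter.Eventually.of_forall fun y => (Real.norm_eq_abs _).le.trans (hB _))
  rw [condMean, ← Real.norm_eq_abs]
  exact h.trans (mul_le_of_le_one_right hB0 measureReal_le_one)

/-- **FIBRE INTEGRAL OF A DRESSED DENSITY = FIBRE MASS × CONDITIONAL MEAN**: for `0 ≤ w ≤ C` measurable and a nonnegative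
bounded measurable weight `g`, `∫dV⌈_s(w·g)(V) = ∫dV⌈_s w(V) · E^{w}_s[g | V_out]` — including the degenerate fibres, where
both sides vanish. [folklore] -/
theorem fibreIntegral_mul_eq_mul_condMean (s : Finset (PBond P j)) {w : Density P j G} (hm : Measurable w)
    (h0 : ∀ U, 0 ≤ w U) {C : ℝ} (hC : ∀ U, w U ≤ C) {g : Density P j G} (hg : Measurable g) (hg0 : ∀ U, 0 ≤ g U)
    {B : ℝ} (hgB : ∀ U, g U ≤ B) (V : GaugeField P j G) :
    fibreIntegral s (fun U => w U * g U) V = fibreIntegral s w V * condMean s w g V := by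
  by_cases hne : fibreIntegral s w V = 0
  · have hle := fibreIntegral_mul_le_at s h0 hC V ((hg0 V).trans (hgB V)) (w := g)
      (fun y _ => hgB (Function.updateFinset V s y))
    rw [hne, mul_zero] at hle
    rw [le_antisymm hle (fibreIntegral_nonneg s _ V), hne, zero_mul]
  · rw [condMean_eq_fibreIntegral_div s hm h0 hg hg0 V, mul_div_cancel₀ _ hne]

/-- `∫dV w·g = ∫dV ∫dV⌈_s w(V) · E^{w}_s[g | V_out]` (tower identity + the previous lemma). [folklore] -/
theorem integral_mul_eq_integral_fibreIntegral_mul_condMean (s : Finset (PBond P j)) {w : Density P j G}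
    (hm : Measurable w) (h0 : ∀ U, 0 ≤ w U) {C : ℝ} (hC : ∀ U, w U ≤ C) {g : Density P j G} (hg : Measurable g)
    (hg0 : ∀ U, 0 ≤ g U) {B : ℝ} (hgB : ∀ U, g U ≤ B) :
    ∫ V, w V * g V ∂fieldMeasure P j G = ∫ V, fibreIntegral s w V * condMean s w g V ∂fieldMeasure P j G := by
  have hpm : Measurable fun U => w U * g U := hm.mul hg
  have hp0 : ∀ U, 0 ≤ w U * g U := fun U => mul_nonneg (h0 U) (hg0 U)
  have hpi : Integrable (fun U => w U * g U) (fieldMeasure P j G) :=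
    integrable_of_measurable_abs_le hpm fun U => by
      rw [abs_of_nonneg (hp0 U)]
      exact mul_le_mul (hC U) (hgB U) (hg0 U) ((h0 U).trans (hC U))
  rw [← integral_fibreIntegral_eq s hpm hp0 hpi]
  exact integral_congr_ae (Filter.Eventually.of_forall fun V => fibreIntegral_mul_eq_mul_condMean s hm h0 hC hg hg0 hgB V)

/-- **THE NORMALISED TERM AGAINST A WEIGHT = OLD FIBRE MASS × INSERT CONDITIONAL MEAN**:
`∫dV normTerm(s,ins,old)(V) g(V) = ∫dV ∫dV⌈_s old(V) · E^{ins}_s[g | V_out]` — the replaced term sees the weight through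
the conditional law of the INSERT. [folklore] -/
theorem integral_normTerm_mul_eq {s : Finset (PBond P j)} {ins old : Density P j G} {C : ℝ}
    (hP : TermProvisos s ins old C) {g : Density P j G} (hg : Measurable g) (hg0 : ∀ U, 0 ≤ g U) {B : ℝ}
    (hgB : ∀ U, g U ≤ B) :
    ∫ V, normTerm s ins old V * g V ∂fieldMeasure P j G
      = ∫ V, fibreIntegral s old V * condMean s ins g V ∂fieldMeasure P j G := by
  have hqI : FibreIndep s fun V => fibreIntegral s old V / fibreIntegral s ins V := fun x y => by
    dsimp only
    rw [fibreIndep_fibreIntegral s old x y, fibreIndep_fibreIntegral s ins x y]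
  have hq0 : ∀ V, 0 ≤ fibreIntegral s old V / fibreIntegral s ins V := fun V =>
    div_nonneg (fibreIntegral_nonneg s old V) (fibreIntegral_nonneg s ins V)
  have hqm : Measurable fun V => fibreIntegral s old V / fibreIntegral s ins V :=
    (measurable_fibreIntegral s hP.old_meas).div (measurable_fibreIntegral s hP.ins_meas)
  have hpt : ∀ V, normTerm s ins old V * g V
      = ins V * g V * (fibreIntegral s old V / fibreIntegral s ins V) := fun V => by
    simp only [normTerm]; ring
  have hgB' : ∀ V, |g V| ≤ B := fun V => by rw [abs_of_nonneg (hg0 V)]; exact hgB V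
  have hf_m : Measurable fun V => ins V * g V * (fibreIntegral s old V / fibreIntegral s ins V) :=
    (hP.ins_meas.mul hg).mul hqm
  have hf_0 : ∀ V, 0 ≤ ins V * g V * (fibreIntegral s old V / fibreIntegral s ins V) := fun V =>
    mul_nonneg (mul_nonneg (hP.ins_nonneg V) (hg0 V)) (hq0 V)
  have hf_i : Integrable (fun V => ins V * g V * (fibreIntegral s old V / fibreIntegral s ins V)) (fieldMeasure P j G) :=
    (integrable_mul_bdd hP.integrable_normTerm hg hgB').congr (Filter.Eventually.of_forall hpt)
  simp_rw [hpt]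
  rw [← integral_fibreIntegral_eq s hf_m hf_0 hf_i]
  refine integral_congr_ae (Filter.Eventually.of_forall fun V => ?_)
  show fibreIntegral s (fun V => ins V * g V * (fibreIntegral s old V / fibreIntegral s ins V)) V
    = fibreIntegral s old V * condMean s ins g V
  rw [fibreIntegral_mul_of_fibreIndep s (f := fun V => ins V * g V) (hP.ins_meas.mul hg) hqI hq0 V,
    fibreIntegral_mul_eq_mul_condMean s hP.ins_meas hP.ins_nonneg hP.ins_le hg hg0 hgB V]
  calc fibreIntegral s old V / fibreIntegral s ins V * (fibreIntegral s ins V * condMean s ins g V)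
      = fibreIntegral s old V / fibreIntegral s ins V * fibreIntegral s ins V * condMean s ins g V := by ring
    _ = fibreIntegral s old V * condMean s ins g V := by rw [div_mul_cancel₀ _ (hP.den_ne V)]

/-- `V ↦ ∫dV⌈_s old(V) · E^{w}_s[g | V_out]` is integrable (bounded by `C·B`, measurable). [folklore] -/
theorem integrable_fibreIntegral_mul_condMean {s : Finset (PBond P j)} {old w : Density P j G} {C : ℝ}
    (hom : Measurable old) (ho0 : ∀ U, 0 ≤ old U) (hoC : ∀ U, old U ≤ C) (hwm : Measurable w) (hw0 : ∀ U, 0 ≤ w U)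
    (hwC : ∀ U, w U ≤ C) {g : Density P j G} (hg : Measurable g) (hg0 : ∀ U, 0 ≤ g U) {B : ℝ} (hgB : ∀ U, g U ≤ B) :
    Integrable (fun V => fibreIntegral s old V * condMean s w g V) (fieldMeasure P j G) :=
  integrable_of_measurable_abs_le ((measurable_fibreIntegral s hom).mul (measurable_condMean s hwm hw0 hg hg0))
    (B := C * B)
    fun V => by
      rw [abs_mul, abs_of_nonneg (fibreIntegral_nonneg s old V)]
      exact mul_le_mul (fibreIntegral_le_of_le s ((ho0 V).trans (hoC V)) hoC V)
        (abs_condMean_le s hwC (fun U => by rw [abs_of_nonneg (hg0 U)]; exact hgB U) V) (abs_nonneg _)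
        ((ho0 V).trans (hoC V))

/-- **THE EXACT CONDITIONAL-MEAN FORM OF ONE INCREMENT**: for a nonnegative bounded measurable weight,
`termDefect s ins old g = ∫dV ∫dV⌈_s old(V) · (E^{old}_s[g | V_out] − E^{ins}_s[g | V_out])` — the increment is the old
term's fibre mass integrated against the DIFFERENCE OF THE CONDITIONAL MEANS of the weight under the old fibre law and under
the insert's (= the difference of the two `D′(0)` of `T4DressingDefect`: the «μ-derivative of the effective action» of the
seat's technique, increment by increment). [folklore] -/
theorem termDefect_eq_integral_fibreIntegral_mul_sub {s : Finset (PBond P j)} {ins old : Density P j G} {C : ℝ}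
    (hP : TermProvisos s ins old C) {g : Density P j G} (hg : Measurable g) (hg0 : ∀ U, 0 ≤ g U) {B : ℝ}
    (hgB : ∀ U, g U ≤ B) :
    termDefect s ins old g
      = ∫ V, fibreIntegral s old V * (condMean s old g V - condMean s ins g V) ∂fieldMeasure P j G := by
  rw [termDefect, integral_mul_eq_integral_fibreIntegral_mul_condMean s hP.old_meas hP.old_nonneg hP.old_le hg hg0 hgB,
    integral_normTerm_mul_eq hP hg hg0 hgB,
    ← integral_sub
      (integrable_fibreIntegral_mul_condMean hP.old_meas hP.old_nonneg hP.old_le hP.old_meas hP.old_nonneg hP.old_le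
        hg hg0 hgB)
      (integrable_fibreIntegral_mul_condMean hP.old_meas hP.old_nonneg hP.old_le hP.ins_meas hP.ins_nonneg hP.ins_le
        hg hg0 hgB)]
  simp only [mul_sub]

/-- HYPOTHESIS SHAPE — **THE LOCATED MISSING INEQUALITY OF THE TECHNIQUE** (named, never asserted, NOT printed anywhere in
the series): the conditional means of the weight `g` under the old term's fibre law and under the insert's fibre law differ
by at most `ε`, at every exterior field through which the old term has mass.  For the pulled-back unit loop weights of the
cell this is the first-order content of NE1′ (b) «conditional-mean suppression» with the insert as comparison law; the
cell's candidate size `ε ≲ c·g_j²M⁴R_j²(θ₁φ)^{K−j}` (row O3.E-i′, Q22) is programme-internal and not used here. [folklore] -/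
def CondMeanGap (s : Finset (PBond P j)) (ins old : Density P j G) (g : GaugeField P j G → ℝ) (ε : ℝ) : Prop :=
  ∀ V, fibreIntegral s old V ≠ 0 → |condMean s old g V - condMean s ins g V| ≤ ε

/-- **THE CONDITIONAL-MEAN SIZE OF ONE INCREMENT**: under `CondMeanGap s ins old g ε`,
`|termDefect s ins old g| ≤ ε·∫dV old` — «difference of conditional means × the term's mass», the size the seat's technique
needs per term (compare the first-order `abs_termDefect_le_of_osc`: `2·sup-oscillation × mass`). [folklore] -/
theorem abs_termDefect_le_of_condMeanGap {s : Finset (PBond P j)} {ins old : Density P j G} {C : ℝ}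
    (hP : TermProvisos s ins old C) {g : Density P j G} (hg : Measurable g) (hg0 : ∀ U, 0 ≤ g U) {B : ℝ}
    (hgB : ∀ U, g U ≤ B) {ε : ℝ} (hε : CondMeanGap s ins old g ε) :
    |termDefect s ins old g| ≤ ε * ∫ V, old V ∂fieldMeasure P j G := by
  have hε0 : ∀ V, |fibreIntegral s old V * (condMean s old g V - condMean s ins g V)| ≤ fibreIntegral s old V * ε := by
    intro V
    rw [abs_mul, abs_of_nonneg (fibreIntegral_nonneg s old V)]
    by_cases hne : fibreIntegral s old V = 0
    · rw [hne, zero_mul, zero_mul]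
    · exact mul_le_mul_of_nonneg_left (hε V hne) (fibreIntegral_nonneg s old V)
  rw [termDefect_eq_integral_fibreIntegral_mul_sub hP hg hg0 hgB, ← Real.norm_eq_abs]
  refine (norm_integral_le_of_norm_le
    ((integrable_of_measurable_abs_le (measurable_fibreIntegral s hP.old_meas) (B := C) fun V => by
        rw [abs_of_nonneg (fibreIntegral_nonneg s old V)]
        exact fibreIntegral_le_of_le s (hP.nonneg_C V) hP.old_le V).mul_const ε)
    (Filter.Eventually.of_forall fun V => (Real.norm_eq_abs _).le.trans (hε0 V))).trans (le_of_eq ?_)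
  rw [integral_mul_const, integral_fibreIntegral_eq s hP.old_meas hP.old_nonneg hP.integrable_old, mul_comm]

/-- **ONE ℝ-STEP OF THE TECHNIQUE, ASSEMBLED**: if every term of (0.3) satisfies `CondMeanGap` for the (nonnegative,
bounded, measurable) weight with its own `ε_Z`, the defect of the whole operation is at most `Σ_Z ε_Z · ∫dV ρ(Z,·)` —
«Σ over terms of (conditional-mean gap × mass)», the per-step size `a k` to be fed into §2.  Everything quantitative
(the decay of `ε_Z` in the scale distance, the summability of the masses of the large-field terms) is OUTSIDE this module.
[folklore] -/
theorem abs_defect_ropReal_le_sum {R : Type*} [Fintype R] (piece : R → Density P j G) (pp : R → R)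
    (fib : R → Finset (PBond P j)) {C : ℝ} (hP : ∀ Z, TermProvisos (fib Z) (piece (pp Z)) (piece Z) C)
    {g : GaugeField P j G → ℝ} (hg : Measurable g) (hg0 : ∀ U, 0 ≤ g U) {B : ℝ} (hgB : ∀ U, g U ≤ B) {ε : R → ℝ}
    (hε : ∀ Z, CondMeanGap (fib Z) (piece (pp Z)) (piece Z) g (ε Z)) :
    |(∫ V, (∑ Z, piece Z V) * g V ∂fieldMeasure P j G) - ∫ V, RopReal piece pp fib V * g V ∂fieldMeasure P j G|
      ≤ ∑ Z, ε Z * ∫ V, piece Z V ∂fieldMeasure P j G := by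
  rw [defect_ropReal_eq_sum piece pp fib hP hg (B := B) fun V => by rw [abs_of_nonneg (hg0 V)]; exact hgB V]
  exact (Finset.abs_sum_le_sum_abs _ _).trans
    (Finset.sum_le_sum fun Z _ => abs_termDefect_le_of_condMeanGap (hP Z) hg hg0 hgB (hε Z))

end OneTerm

/-! ## §4 The cell's data: the realised run IS a printed chain, so the telescoping identity holds for it unconditionally -/

section CellData

open T4Continuum Missing

variable {F : T4Family} {G : Type*} [GaugeGroup G] [MeasurableSpace G] [HaarData G]

/-- The realised run `(K, g₀)` of `D : FiniteEpsData F G` is a printed chain (fields `Realisation.isRT_Trho`,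
`Realisation.rho_succ_eq`; `T4Spectator.rho` = `FiniteEpsData.dens`). [cite: Balaban1988Convergent, (0.2) p.244] -/
theorem printedChain_rho (D : FiniteEpsData F G) (K : ℕ) (g₀ : ℝ) :
    PrintedChain (D.av K) (rho D K g₀) (D.real.Trho K g₀) (D.real.R K g₀) K :=
  ⟨fun k hk => D.real.isRT_Trho K g₀ k hk, fun k hk => rho_succ_eq_R_Trho D K g₀ k hk⟩

/-- **THE TELESCOPING IDENTITY FOR THE CELL'S DATA** (unconditional given `D.AvgMeasurable`): for every bounded measurable
weight `f` on the unit lattice, `∫dU ρ₀(U) f(Ū^K) = ∫dV ρ_K(V) f(V) + telescopeSum`, the sum of the ℝ-defects of the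
pulled-back weight along the realised run. [folklore] -/
theorem integral_rho_zero_mul_comp_iter_eq (D : FiniteEpsData F G) (hM : D.AvgMeasurable) (K : ℕ) (g₀ : ℝ)
    (f : GaugeField (F.P K) K G → ℝ) (hf : Measurable f) (hfb : ∃ C : ℝ, ∀ V, |f V| ≤ C) :
    ∫ U, rho D K g₀ 0 U * f (Averaging.iter (D.av K) K U) ∂fieldMeasure (F.P K) 0 G
      = ∫ V, rho D K g₀ K V * f V ∂fieldMeasure (F.P K) K G
          + telescopeSum (D.av K) (D.real.Trho K g₀) (D.real.R K g₀) K f :=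
  integral_zero_mul_comp_iter_eq (D.av K) (hM K) (rho D K g₀) (D.real.Trho K g₀) (D.real.R K g₀) K
    (printedChain_rho D K g₀) f hf hfb

/-- `T4Spectator.RWeaklyInvisible D K g₀` IS `WeaklyInvisible` of the realised transforms and operations, and kills the
telescoping sum (so `T4Spectator.expect_comp_iter_eq` is the `telescopeSum = 0` case of the next theorem). [folklore] -/
theorem telescopeSum_rho_eq_zero_of_invisible (D : FiniteEpsData F G) (hM : D.AvgMeasurable) (K : ℕ) (g₀ : ℝ)
    (hR : RWeaklyInvisible D K g₀) (f : GaugeField (F.P K) K G → ℝ) (hf : Measurable f)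
    (hfb : ∃ C : ℝ, ∀ V, |f V| ≤ C) : telescopeSum (D.av K) (D.real.Trho K g₀) (D.real.R K g₀) K f = 0 :=
  telescopeSum_eq_zero_of_weaklyInvisible (D.av K) (hM K) (D.real.Trho K g₀) (D.real.R K g₀) K hR f hf hfb

/-- **FINITE-ε EXPECTATIONS, UNCONDITIONALLY**: for every bounded measurable `f` of the unit-lattice field,
`⟨f(Ū^K)⟩_{F.P K, g₀⁻²} = (∫dV ρ_K f + telescopeSum)/∫dV ρ_K` — the Wilson expectation of the averaged observable is its
`ρ_K`-expectation plus the normalised sum of the ℝ-defects of its pull-backs ((0.4) for the denominator,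
`FiniteEpsData.integral_dens_top`'s mechanism; no invisibility hypothesis). [folklore] -/
theorem expect_comp_iter_eq_telescope (D : FiniteEpsData F G) (hM : D.AvgMeasurable) (K : ℕ) (g₀ : ℝ)
    (f : GaugeField (F.P K) K G → ℝ) (hf : Measurable f) (hfb : ∃ C : ℝ, ∀ V, |f V| ≤ C) :
    expect (F.P K) (g₀⁻¹ ^ 2) (fun U => f (Averaging.iter (D.av K) K U))
      = (∫ V, rho D K g₀ K V * f V ∂fieldMeasure (F.P K) K G
            + telescopeSum (D.av K) (D.real.Trho K g₀) (D.real.R K g₀) K f)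
          / ∫ V, rho D K g₀ K V ∂fieldMeasure (F.P K) K G := by
  obtain ⟨c, hc, h0⟩ := rho_zero_eq D K g₀
  have h0' : rho D K g₀ 0 = fun U => c * boltzmann (F.P K) (g₀⁻¹ ^ 2) U := funext h0
  have e1 : ∫ U, c * boltzmann (F.P K) (g₀⁻¹ ^ 2) U * f (Averaging.iter (D.av K) K U) ∂fieldMeasure (F.P K) 0 G
      = c * ∫ U, f (Averaging.iter (D.av K) K U) * boltzmann (F.P K) (g₀⁻¹ ^ 2) U ∂fieldMeasure (F.P K) 0 G := by
    rw [← integral_const_mul]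
    congr 1
    funext U
    ring
  have e2 : ∫ U, c * boltzmann (F.P K) (g₀⁻¹ ^ 2) U ∂fieldMeasure (F.P K) 0 G
      = c * ∫ U, boltzmann (F.P K) (g₀⁻¹ ^ 2) U ∂fieldMeasure (F.P K) 0 G :=
    integral_const_mul c _
  have hK : ∫ V, rho D K g₀ K V ∂fieldMeasure (F.P K) K G = ∫ U, rho D K g₀ 0 U ∂fieldMeasure (F.P K) 0 G :=
    integral_eq_integral_zero_of_printedChain (D.av K) (rho D K g₀) (D.real.Trho K g₀) (D.real.R K g₀) K
      (printedChain_rho D K g₀) (fun k hk => D.real.preservesIntegral_R K g₀ k hk)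
  simp only [expect, partitionFn]
  rw [← integral_rho_zero_mul_comp_iter_eq D hM K g₀ f hf hfb, hK, h0', e1, e2, mul_div_mul_left _ _ hc.ne']

end CellData

/-! ## §5 (v1.1) Consumer seams: one-law deviations, the first/second-order channel split, the normalised bound

Record `HOME/t4/T4-EST-NE1p-P3.md` §3 (CM) splits the conditional-mean gap of one increment into ONE-LAW deviations from a
fibre-independent reference functional `m` (e.g. the weight evaluated at a reference configuration of the fibre determined by
`V_out`, such as the minimiser of Proposition 1, p. 194 — CONTEXT only), and each deviation into a FIRST-ORDER channel (the
conditional mean of a «linear part» `ℓ`) and a SECOND-ORDER channel (the size of the remainder `g − m − ℓ` on the support of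
the law).  The lemmas below are that bookkeeping and nothing more: NO size for Bałaban's laws is asserted (GAPS G-ne1p3-1,
G-ne1p3-2 of the cell: NOT printed, NOT proved). [folklore] -/

section Seams

open B15.BasicStep T4DressedR T4DressingDefect

variable {P : Params} {j : ℕ} {G : Type*} [GaugeGroup G] [MeasurableSpace G] [HaarData G]
variable [DecidableEq (PBond P j)]

/-- ONE-LAW DEVIATION (hypothesis shape): `|E^{w}_s[g | V_out] − m(V)| ≤ ε` wherever the fibre integral of `w` at `V` is
non-zero. [folklore] -/
def CondMeanDev (s : Finset (PBond P j)) (w : Density P j G) (g m : GaugeField P j G → ℝ) (ε : ℝ) : Prop :=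
  ∀ V, fibreIntegral s w V ≠ 0 → |condMean s w g V - m V| ≤ ε

/-- TWO LAWS FROM ONE REFERENCE (triangle inequality): deviations `ε₁` (old law) and `ε₂` (insert law) from the SAME
reference functional give `CondMeanGap … (ε₁ + ε₂)`; `hden` is implied by the printed proviso «the denominators are
positive» (`TermProvisos.den_ne` gives it outright). [folklore] -/
theorem condMeanGap_of_dev {s : Finset (PBond P j)} {ins old : Density P j G} {g m : GaugeField P j G → ℝ} {ε₁ ε₂ : ℝ}
    (hden : ∀ V, fibreIntegral s old V ≠ 0 → fibreIntegral s ins V ≠ 0) (h₁ : CondMeanDev s old g m ε₁)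
    (h₂ : CondMeanDev s ins g m ε₂) : CondMeanGap s ins old g (ε₁ + ε₂) := by
  intro V hne
  have e : condMean s old g V - condMean s ins g V
      = (condMean s old g V - m V) - (condMean s ins g V - m V) := by ring
  rw [e]
  exact (abs_sub _ _).trans (add_le_add (h₁ V hne) (h₂ V (hden V hne)))

/-- … in particular under the printed provisos of one term. [folklore] -/
theorem condMeanGap_of_dev' {s : Finset (PBond P j)} {ins old : Density P j G} {C : ℝ} (hP : TermProvisos s ins old C)
    {g m : GaugeField P j G → ℝ} {ε₁ ε₂ : ℝ} (h₁ : CondMeanDev s old g m ε₁) (h₂ : CondMeanDev s ins g m ε₂) :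
    CondMeanGap s ins old g (ε₁ + ε₂) :=
  condMeanGap_of_dev (fun V _ => hP.den_ne V) h₁ h₂

/-- Bounded measurable functions of the fibre variables are integrable for the conditional law. [folklore] -/
theorem integrable_condLaw_of_abs_le (s : Finset (PBond P j)) {w : Density P j G} {C : ℝ} (hC : ∀ U, w U ≤ C)
    {h : Density P j G} (hh : Measurable h) {B : ℝ} (hB : ∀ U, |h U| ≤ B) (V : GaugeField P j G) :
    Integrable (fun y : s → G => h (Function.updateFinset V s y)) (condLaw s w V) := by
  haveI := isZeroOrProbabilityMeasure_condLaw s hC V (old := w)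
  exact Integrable.of_bound (hh.comp measurable_updateFinset).aestronglyMeasurable B
    (Filter.Eventually.of_forall fun y => (Real.norm_eq_abs _).le.trans (hB _))

/-- Linearity of the conditional mean in the integrand (bounded measurable integrands). [folklore] -/
theorem condMean_sub (s : Finset (PBond P j)) {w : Density P j G} {C : ℝ} (hC : ∀ U, w U ≤ C)
    {g₁ g₂ : Density P j G} (hg₁ : Measurable g₁) (hg₂ : Measurable g₂) {B₁ B₂ : ℝ} (hB₁ : ∀ U, |g₁ U| ≤ B₁)
    (hB₂ : ∀ U, |g₂ U| ≤ B₂) (V : GaugeField P j G) :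
    condMean s w (fun U => g₁ U - g₂ U) V = condMean s w g₁ V - condMean s w g₂ V := by
  simp only [condMean]
  exact integral_sub (integrable_condLaw_of_abs_le s hC hg₁ hB₁ V) (integrable_condLaw_of_abs_le s hC hg₂ hB₂ V)

/-- The conditional mean of a FIBRE-INDEPENDENT functional is the functional itself (non-degenerate case) — the typed form of
«a reference value determined by `V_out`» costing nothing. [folklore] -/
theorem condMean_of_fibreIndep (s : Finset (PBond P j)) {w : Density P j G} {C : ℝ} (hC : ∀ U, w U ≤ C)
    {m : Density P j G} (hmI : FibreIndep s m) (V : GaugeField P j G) (hne : fibreIntegral s w V ≠ 0) :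
    condMean s w m V = m V := by
  haveI := isProbabilityMeasure_condLaw s hC V hne
  simp only [condMean, hmI V, integral_const, probReal_univ, one_smul]

/-- THE FIRST/SECOND-ORDER CHANNEL SPLIT of a one-law deviation: if on the SUPPORT of the law the weight equals its
reference value plus a «linear part» `ℓ` plus a remainder of size `≤ q` — `|g(V←y) − m(V) − ℓ(V←y)| ≤ q` whenever
`w(V←y) ≠ 0` — and the conditional mean of the linear part is `≤ p` in absolute value wherever the fibre integral is
non-zero, then the deviation is `≤ p + q`.  (Cell reading, record §3: `ℓ` = the first-order Taylor term of the pulled-back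
loop in the fluctuation variables of the fibre, `p` = the conditional-mean channel (R1) — `T4FirstOrderSize.CondMeanSuppression`
-type data —, `q` = the second-order channel (R2); their sizes for Bałaban's laws are NOT asserted anywhere in the tree.)
[folklore] -/
theorem condMeanDev_of_channels (s : Finset (PBond P j)) {w : Density P j G} (hm : Measurable w) {C : ℝ}
    (hC : ∀ U, w U ≤ C) {g m ℓ : Density P j G} (hg : Measurable g) (hmm : Measurable m) (hℓ : Measurable ℓ)
    {Bg Bm Bℓ : ℝ} (hBg : ∀ U, |g U| ≤ Bg) (hBm : ∀ U, |m U| ≤ Bm) (hBℓ : ∀ U, |ℓ U| ≤ Bℓ) (hmI : FibreIndep s m)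
    {p q : ℝ} (hp : ∀ V, fibreIntegral s w V ≠ 0 → |condMean s w ℓ V| ≤ p)
    (hq : ∀ (V : GaugeField P j G) (y : s → G), w (Function.updateFinset V s y) ≠ 0 →
      |g (Function.updateFinset V s y) - m V - ℓ (Function.updateFinset V s y)| ≤ q) :
    CondMeanDev s w g m (p + q) := by
  intro V hne
  haveI := isProbabilityMeasure_condLaw s hC V hne
  have hgm : ∀ U, |g U - m U| ≤ Bg + Bm := fun U => (abs_sub _ _).trans (add_le_add (hBg U) (hBm U))
  -- the remainder `g − m − ℓ` has conditional mean `≤ q` in absolute value (support transfer)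
  have hq' : |condMean s w (fun U => g U - m U - ℓ U) V| ≤ q := by
    rw [condMean, ← Real.norm_eq_abs]
    have h := norm_integral_le_of_norm_le_const (μ := condLaw s w V)
      (f := fun y : s → G => g (Function.updateFinset V s y) - m (Function.updateFinset V s y)
        - ℓ (Function.updateFinset V s y)) (C := q)
      (ae_condLaw_of_support s hm V fun y hy => by
        rw [Real.norm_eq_abs, hmI V y]; exact hq V y hy)
    rwa [probReal_univ, mul_one] at h
  -- the decomposition `E[g] − m(V) = E[g − m − ℓ] + E[ℓ]`
  have e : condMean s w g V - m V = condMean s w (fun U => g U - m U - ℓ U) V + condMean s w ℓ V := by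
    rw [condMean_sub s hC (hg.sub hmm) hℓ (g₁ := fun U => g U - m U) hgm hBℓ V,
      condMean_sub s hC hg hmm hBg hBm V, condMean_of_fibreIndep s hC hmI V hne]
    ring
  rw [e]
  exact (abs_add_le _ _).trans ((add_le_add hq' (hp V hne)).trans (le_of_eq (add_comm q p)))

end Seams

/-! ### The normalised bound (abstract chain and the cell's data) -/

section SeamsChain

variable {P : Params} {G : Type*} [GaugeGroup G] [MeasurableSpace G] [HaarData G]

/-- `|⟨f(Ū^K)⟩_{ρ₀} − ⟨f⟩_{ρ_K}| ≤ (Σ_{k<K} a_k)/∫ρ_K` along a printed chain whose ℝ-steps preserve total integrals, under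
per-step defect sizes `a`. [folklore] -/
theorem abs_ratio_comp_iter_sub_le (av : ∀ j, Averaging P j G) (hav : ∀ j, Measurable (av j).avg)
    (ρ : (k : ℕ) → Density P k G) (Tρ : (k : ℕ) → Density P (k + 1) G)
    (R : (k : ℕ) → Density P (k + 1) G → Density P (k + 1) G) (K : ℕ) (hch : PrintedChain av ρ Tρ R K)
    (hR : ∀ k, k < K → PreservesIntegral (R k)) (f : GaugeField P K G → ℝ) (hf : Measurable f)
    (hfb : ∃ C : ℝ, ∀ V, |f V| ≤ C) (a : ℕ → ℝ) (ha : DefectBoundedBy av Tρ R a K f)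
    (hZ : 0 < ∫ V, ρ K V ∂fieldMeasure P K G) :
    |(∫ U, ρ 0 U * f (Averaging.iter av K U) ∂fieldMeasure P 0 G) / (∫ U, ρ 0 U ∂fieldMeasure P 0 G)
        - (∫ V, ρ K V * f V ∂fieldMeasure P K G) / (∫ V, ρ K V ∂fieldMeasure P K G)|
      ≤ (∑ k ∈ Finset.range K, a k) / ∫ V, ρ K V ∂fieldMeasure P K G := by
  rw [ratio_comp_iter_eq av hav ρ Tρ R K hch hR f hf hfb, add_div, add_sub_cancel_left, abs_div, abs_of_pos hZ]
  exact div_le_div_of_nonneg_right (abs_telescopeSum_le av Tρ R a K f ha) hZ.le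

end SeamsChain

section SeamsCell

open T4Continuum Missing

variable {F : T4Family} {G : Type*} [GaugeGroup G] [MeasurableSpace G] [HaarData G]

/-- THE CELL'S NORMALISED BOUND: for the realised run of `D : FiniteEpsData F G`, per-step defect sizes `a` give
`|⟨f(Ū^K)⟩_ε − ⟨f⟩_{ρ_K}| ≤ (Σ_{k<K} a_k)/∫ρ_K` — the K-uniform seam of the technique (feed `a k ≤ C·r^{K−1−k}` and
`sum_range_le_of_geometric`).  The sizes themselves are NE1′ (GAPS G-ne1p3-1), NOT proved. [folklore] -/
theorem abs_expect_comp_iter_sub_le (D : FiniteEpsData F G) (hM : D.AvgMeasurable) (K : ℕ) (g₀ : ℝ)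
    (f : GaugeField (F.P K) K G → ℝ) (hf : Measurable f) (hfb : ∃ C : ℝ, ∀ V, |f V| ≤ C) (a : ℕ → ℝ)
    (ha : DefectBoundedBy (D.av K) (D.real.Trho K g₀) (D.real.R K g₀) a K f)
    (hZ : 0 < ∫ V, rho D K g₀ K V ∂fieldMeasure (F.P K) K G) :
    |expect (F.P K) (g₀⁻¹ ^ 2) (fun U => f (Averaging.iter (D.av K) K U))
        - (∫ V, rho D K g₀ K V * f V ∂fieldMeasure (F.P K) K G) / ∫ V, rho D K g₀ K V ∂fieldMeasure (F.P K) K G|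
      ≤ (∑ k ∈ Finset.range K, a k) / ∫ V, rho D K g₀ K V ∂fieldMeasure (F.P K) K G := by
  rw [expect_comp_iter_eq_telescope D hM K g₀ f hf hfb, add_div, add_sub_cancel_left, abs_div, abs_of_pos hZ]
  exact div_le_div_of_nonneg_right (abs_telescopeSum_le (D.av K) (D.real.Trho K g₀) (D.real.R K g₀) a K f ha) hZ.le

end SeamsCell

end Literature.MathematicalPhysics.QuantumFieldTheory.Balaban1983to89.T4ObservableTelescope

end
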